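import Summits.Ventures.CertifiedManyBodySolver.Theses.CovLa214M2b
import Summits.Ventures.CertifiedManyBodySolver.Observables.StiffnessApexTransportCurtainTopShadow
import Summits.Ventures.CertifiedManyBodySolver.Downfold.BoxesLa214V115M2bCurtainTop
import Summits.Ventures.CertifiedManyBodySolver.Observables.StiffnessApexTransportCurtainLadderLaBoxE
import HarnessLib

/-!
# Route CovLa214M2b — closers of the crux `TransportFanCeiling` (stmt-Ventures-26184) from the (E6) pieces: the SHORT corner-objective overhang at the
# station `29/5` + the TOP of the left edge `t′ = −3/10` (the «74/5 insurance» objects), no far vertex, no inner family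

Venture CertifiedManyBodySolver, route «CovLa214M2b» (Theses/CovLa214M2b.lean rev 0; route pen hubbard-m2-certneg-1); seat `hubbard-cov-la214-unc-2`
(`prover-hubbard-cov-la214-unc-2-0`, D-0154 (1)(C) COVERAGE, La214; captain LA214-COVERAGE-PLAN v1.0 §5 maps this seat to item 26184). The item
`TransportFanCeiling` = every La214-E target `(t′, U)` whose apex source at the station `29/5` leaves the box, `t′(2 − (29/5)/U) ≤ −3/10`, carries
`ObsStiffnessSeqCeilingAt t′ U 1 (4364687/10⁷)`. The route's producer of record is the (E1) corner-objective overhang bundle on `[−357/740, −3/10] × {29/5}`;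
here are the one-`exact` closers from the ALTERNATIVE objects that sdp-1/sdp-2 fired 05:23–06:02Z (LEGS C2/C3/C5/L1/L3): corner-objective words on the SHORT
overhang `[(−3/10)(2 − (29/5)/U_L), −3/10] × {29/5}` plus own words on the left-edge top `{−3/10} × [U_L, 74/5]`
(`Observables/StiffnessApexTransportCurtainTopShadow`, this seat). Every hypothesis is a PRODUCER deliverable (unconditional orbit-lower family with
its price `−val ≤ 0.4364687`); nothing here is a number of record.

* `transportFanCeiling_of_shortOverhang_and_leftEdgeTop UL …` — any window height `U_L ∈ [29/5, 74/5]` (family form);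
* `transportFanCeiling_of_shortOverhang153o400_and_leftEdgeTop8 …` — `U_L = 8`: overhang `[−153/400, −3/10]`, left-top `[8, 74/5]` (family form);
* `transportFanCeiling_of_outerBundleOfRecord_and_leftEdgeTop8Chord vO₁ vO₂ vL₁ vL₂ …` — the (E1) OUTER CHORD OF RECORD on `[−357/740, −3/10]` (vertices
  `vO₁` at `−357/740` = leg j298996's slot, `vO₂` at `−3/10` = B2 j298764) read only on `[−153/400, −3/10]`, plus the left-top `U`-chord (`vL₁` at `U = 8` = C3,
  `vL₂` at `U = 74/5` = C2): conditions `−vO₂, −vL₁, −vL₂ ≤ 0.4364687` and the RELAXED far-vertex condition `−(407/900·vO₁ + 493/900·vO₂) ≤ 0.4364687`.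

HONEST FRAMING: CONDITIONAL closers (the item closes only when the named families/constants are certified by claim nodes); stiffness CEILINGS on a
downfolded box = CONTROL/CALIBRATION + labelled heuristic, silent on `ρ_s = 0`; no number, no certificate, no phase sentence; no summit statement is
proved by this seat.
-/

noncomputable section

namespace Summit.Ventures.CertifiedManyBodySolver.Theorems

open Summit.Ventures.CertifiedManyBodySolver.Theses.CovLa214M2b
open Summit.Ventures.CertifiedManyBodySolver.Observables
open Summit.Ventures.CertifiedManyBodySolver.Downfold
open Literature.MathematicalPhysics.QuantumLattice Literature.MathematicalPhysics.QuantumLattice.ThermodynamicLimit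
open Literature.Probability.LatticeModels
open Matrix Finset HubbardWave0
open scoped BigOperators ComplexOrder

/-- The item's antecedent `t′(2 − (29/5)/U)` is the kernel files' station source `t′(2U − 29/5)/U` (`U ≠ 0`). [folklore] -/
theorem la214E_stationSource_eq {tp U : ℝ} (hU : U ≠ 0) : tp * (2 - 29 / 5 / U) = tp * (2 * U - 29 / 5) / U := by
  field_simp

/-- **`TransportFanCeiling` from the SHORT overhang + the LEFT-EDGE TOP, any window height `U_L ∈ [29/5, 74/5]`.** A corner-objective (`−X₀(−3/10)`)
orbit-lower family `valO` on `[(−3/10)(2 − (29/5)/U_L), −3/10] × {29/5}` and an own-word family `valL` on `{−3/10} × [U_L, 74/5]` (half filling), both priced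
`−val ≤ 0.4364687`, close the item. [cite: KomaTasaki1994, §1] [cite: ScalapinoWhiteZhang1993, §II] -/
theorem transportFanCeiling_of_shortOverhang_and_leftEdgeTop (UL : ℝ) (hAL : 29 / 5 ≤ UL) (valO valL : ℝ → ℝ)
    (hO : ∀ s ∈ Set.Icc (-3 / 10 * (2 - 29 / 5 / UL) : ℝ) (-3 / 10),
      ∀ (ω : InfVolFermionState 2) (Ls : ℕ → ℕ) (ψ : ∀ L, Fock (Orb (FermionTorus 2 L))),
      Filter.Tendsto Ls Filter.atTop Filter.atTop →
      (∀ j, IsGroundStateInSector (hubbardTorusTT' (Ls j) 1 s (29 / 5)) (rectN 1 (Ls j)) 0 (ψ (Ls j))) →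
      (∀ j, star (ψ (Ls j)) ⬝ᵥ ψ (Ls j) = 1) → ω.IsTorusLimitOf ψ Ls →
      valO s ≤ ((Finset.univ : Finset (DihedralGroup 4)).card : ℝ)⁻¹ * ∑ g ∈ (Finset.univ : Finset (DihedralGroup 4)),
        (ω.expect (d4ShiftSet g 0 (Literature.Probability.LatticeModels.box 2 7))
          (fermionEmbed (PolySite.d4Emb g 0 (Literature.Probability.LatticeModels.box 2 7)) (-oddMomentObsTT (-3 / 10) (29 / 5) 0))).re)
    (hcO : ∀ s ∈ Set.Icc (-3 / 10 * (2 - 29 / 5 / UL) : ℝ) (-3 / 10), -valO s ≤ ((4364687 / 10000000 : ℚ) : ℝ))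
    (hL : ∀ U' ∈ Set.Icc UL (74 / 5),
      ∀ (ω : InfVolFermionState 2) (Ls : ℕ → ℕ) (ψ : ∀ L, Fock (Orb (FermionTorus 2 L))),
      Filter.Tendsto Ls Filter.atTop Filter.atTop →
      (∀ j, IsGroundStateInSector (hubbardTorusTT' (Ls j) 1 (-3 / 10) U') (rectN 1 (Ls j)) 0 (ψ (Ls j))) →
      (∀ j, star (ψ (Ls j)) ⬝ᵥ ψ (Ls j) = 1) → ω.IsTorusLimitOf ψ Ls →
      valL U' ≤ ((Finset.univ : Finset (DihedralGroup 4)).card : ℝ)⁻¹ * ∑ g ∈ (Finset.univ : Finset (DihedralGroup 4)),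
        (ω.expect (d4ShiftSet g 0 (Literature.Probability.LatticeModels.box 2 7))
          (fermionEmbed (PolySite.d4Emb g 0 (Literature.Probability.LatticeModels.box 2 7)) (-oddMomentObsTT (-3 / 10) U' 0))).re)
    (hcL : ∀ U' ∈ Set.Icc UL (74 / 5), -valL U' ≤ ((4364687 / 10000000 : ℚ) : ℝ)) :
    TransportFanCeiling := by
  intro tp htp U hU hs
  have hU0 : U ≠ 0 := ne_of_gt (by linarith [hU.1])
  rw [la214E_stationSource_eq hU0] at hs
  exact ObsStiffnessSeqCeilingAt_on_laBoxE_transportShadow_of_shortOverhang_and_leftEdgeTop UL hAL valO valL (4364687 / 10000000)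
    hO hcO hL hcL tp htp U hU hs

/-- **`TransportFanCeiling` from the SHORT overhang `[−153/400, −3/10] × {29/5}` + the LEFT-EDGE TOP `{−3/10} × [8, 74/5]` (`U_L = 8`, family form).**
[cite: KomaTasaki1994, §1] [cite: ScalapinoWhiteZhang1993, §II] -/
theorem transportFanCeiling_of_shortOverhang153o400_and_leftEdgeTop8 (valO valL : ℝ → ℝ)
    (hO : ∀ s ∈ Set.Icc (-(153 / 400) : ℝ) (-3 / 10),
      ∀ (ω : InfVolFermionState 2) (Ls : ℕ → ℕ) (ψ : ∀ L, Fock (Orb (FermionTorus 2 L))),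
      Filter.Tendsto Ls Filter.atTop Filter.atTop →
      (∀ j, IsGroundStateInSector (hubbardTorusTT' (Ls j) 1 s (29 / 5)) (rectN 1 (Ls j)) 0 (ψ (Ls j))) →
      (∀ j, star (ψ (Ls j)) ⬝ᵥ ψ (Ls j) = 1) → ω.IsTorusLimitOf ψ Ls →
      valO s ≤ ((Finset.univ : Finset (DihedralGroup 4)).card : ℝ)⁻¹ * ∑ g ∈ (Finset.univ : Finset (DihedralGroup 4)),
        (ω.expect (d4ShiftSet g 0 (Literature.Probability.LatticeModels.box 2 7))
          (fermionEmbed (PolySite.d4Emb g 0 (Literature.Probability.LatticeModels.box 2 7)) (-oddMomentObsTT (-3 / 10) (29 / 5) 0))).re)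
    (hcO : ∀ s ∈ Set.Icc (-(153 / 400) : ℝ) (-3 / 10), -valO s ≤ ((4364687 / 10000000 : ℚ) : ℝ))
    (hL : ∀ U' ∈ Set.Icc (8 : ℝ) (74 / 5),
      ∀ (ω : InfVolFermionState 2) (Ls : ℕ → ℕ) (ψ : ∀ L, Fock (Orb (FermionTorus 2 L))),
      Filter.Tendsto Ls Filter.atTop Filter.atTop →
      (∀ j, IsGroundStateInSector (hubbardTorusTT' (Ls j) 1 (-3 / 10) U') (rectN 1 (Ls j)) 0 (ψ (Ls j))) →
      (∀ j, star (ψ (Ls j)) ⬝ᵥ ψ (Ls j) = 1) → ω.IsTorusLimitOf ψ Ls →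
      valL U' ≤ ((Finset.univ : Finset (DihedralGroup 4)).card : ℝ)⁻¹ * ∑ g ∈ (Finset.univ : Finset (DihedralGroup 4)),
        (ω.expect (d4ShiftSet g 0 (Literature.Probability.LatticeModels.box 2 7))
          (fermionEmbed (PolySite.d4Emb g 0 (Literature.Probability.LatticeModels.box 2 7)) (-oddMomentObsTT (-3 / 10) U' 0))).re)
    (hcL : ∀ U' ∈ Set.Icc (8 : ℝ) (74 / 5), -valL U' ≤ ((4364687 / 10000000 : ℚ) : ℝ)) :
    TransportFanCeiling := by
  intro tp htp U hU hs
  have hU0 : U ≠ 0 := ne_of_gt (by linarith [hU.1])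
  rw [la214E_stationSource_eq hU0] at hs
  exact ObsStiffnessSeqCeilingAt_on_laBoxE_transportShadow_of_shortOverhang153o400_and_leftEdgeTop8 valO valL (4364687 / 10000000)
    hO hcO hL hcL tp htp U hU hs

/-- **`TransportFanCeiling` from the (E1) OUTER BUNDLE OF RECORD read on the short overhang + the LEFT-TOP `U`-chord.** The outer chord on `[−357/740, −3/10] × {29/5}`
(`vO₁` at `−357/740`, `vO₂` at `−3/10`, objective `−X₀(−3/10)` — the `hOuter` hypothesis of `La214M2b_StiffnessBoxCeiling_of_apexStation29o5_twoBundles` verbatim) and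
the left-top chord in `U` on `{−3/10} × [8, 74/5]` (`vL₁` at `U = 8`, `vL₂` at `U = 74/5`), with `−vO₂, −vL₁, −vL₂ ≤ 0.4364687` and, in place of a condition on
the far vertex alone, `−(407/900·vO₁ + 493/900·vO₂) ≤ 0.4364687` (the chord's value at `−153/400`), close the item: the far-vertex constant may exceed the bar
by `493/407 ≈ 1.21` times the corner's margin. [cite: KomaTasaki1994, §1] [cite: ScalapinoWhiteZhang1993, §II] -/
theorem transportFanCeiling_of_outerBundleOfRecord_and_leftEdgeTop8Chord (vO₁ vO₂ vL₁ vL₂ : ℝ)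
    (hcOm : -(407 / 900 * vO₁ + 493 / 900 * vO₂) ≤ ((4364687 / 10000000 : ℚ) : ℝ)) (hcO₂ : -vO₂ ≤ ((4364687 / 10000000 : ℚ) : ℝ))
    (hcL₁ : -vL₁ ≤ ((4364687 / 10000000 : ℚ) : ℝ)) (hcL₂ : -vL₂ ≤ ((4364687 / 10000000 : ℚ) : ℝ))
    (hOuter : ∀ s ∈ Set.Icc (-(357 / 740) : ℝ) (-3 / 10),
      ∀ (ω : InfVolFermionState 2) (Ls : ℕ → ℕ) (ψ : ∀ L, Fock (Orb (FermionTorus 2 L))),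
      Filter.Tendsto Ls Filter.atTop Filter.atTop →
      (∀ j, IsGroundStateInSector (hubbardTorusTT' (Ls j) 1 s (29 / 5)) (rectN 1 (Ls j)) 0 (ψ (Ls j))) →
      (∀ j, star (ψ (Ls j)) ⬝ᵥ ψ (Ls j) = 1) → ω.IsTorusLimitOf ψ Ls →
      (-3 / 10 - s) / (-3 / 10 - -(357 / 740)) * vO₁ + (s - -(357 / 740)) / (-3 / 10 - -(357 / 740)) * vO₂ ≤ ((Finset.univ : Finset (DihedralGroup 4)).card : ℝ)⁻¹ * ∑ g ∈ (Finset.univ : Finset (DihedralGroup 4)),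
        (ω.expect (d4ShiftSet g 0 (Literature.Probability.LatticeModels.box 2 7))
          (fermionEmbed (PolySite.d4Emb g 0 (Literature.Probability.LatticeModels.box 2 7)) (-oddMomentObsTT (-3 / 10) (29 / 5) 0))).re)
    (hLeftTop : ∀ U' ∈ Set.Icc (8 : ℝ) (74 / 5),
      ∀ (ω : InfVolFermionState 2) (Ls : ℕ → ℕ) (ψ : ∀ L, Fock (Orb (FermionTorus 2 L))),
      Filter.Tendsto Ls Filter.atTop Filter.atTop →
      (∀ j, IsGroundStateInSector (hubbardTorusTT' (Ls j) 1 (-3 / 10) U') (rectN 1 (Ls j)) 0 (ψ (Ls j))) →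
      (∀ j, star (ψ (Ls j)) ⬝ᵥ ψ (Ls j) = 1) → ω.IsTorusLimitOf ψ Ls →
      (74 / 5 - U') / (74 / 5 - 8) * vL₁ + (U' - 8) / (74 / 5 - 8) * vL₂ ≤ ((Finset.univ : Finset (DihedralGroup 4)).card : ℝ)⁻¹ * ∑ g ∈ (Finset.univ : Finset (DihedralGroup 4)),
        (ω.expect (d4ShiftSet g 0 (Literature.Probability.LatticeModels.box 2 7))
          (fermionEmbed (PolySite.d4Emb g 0 (Literature.Probability.LatticeModels.box 2 7)) (-oddMomentObsTT (-3 / 10) U' 0))).re) :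
    TransportFanCeiling := by
  refine transportFanCeiling_of_shortOverhang153o400_and_leftEdgeTop8
    (fun s => (-3 / 10 - s) / (-3 / 10 - -(357 / 740)) * vO₁ + (s - -(357 / 740)) / (-3 / 10 - -(357 / 740)) * vO₂)
    (fun U' => (74 / 5 - U') / (74 / 5 - 8) * vL₁ + (U' - 8) / (74 / 5 - 8) * vL₂)
    (fun s hs => hOuter s ⟨le_trans (by norm_num) hs.1, hs.2⟩) (fun s hs => ?_) hLeftTop (fun U' hU' => ?_)
  · have hmin := chord_min_le_on_rightSubsegment (a := -(357 / 740)) (b := -3 / 10) (m := -(153 / 400)) (v₁ := vO₁) (v₂ := vO₂)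
      (by norm_num) hs.1 hs.2
    obtain ⟨e1, e2⟩ := la214E_outerChord_weights_at_153o400
    rw [e1, e2] at hmin
    have hneg : -min (407 / 900 * vO₁ + 493 / 900 * vO₂) vO₂ ≤ ((4364687 / 10000000 : ℚ) : ℝ) := by
      rcases le_total (407 / 900 * vO₁ + 493 / 900 * vO₂) vO₂ with hv | hv
      · rw [min_eq_left hv]; exact hcOm
      · rw [min_eq_right hv]; exact hcO₂
    linarith
  · exact neg_chord_le_of_ends (by norm_num) hU' hcL₁ hcL₂


/-! ## (append, same seat) K2 from the INS-B TWIN BUNDLE `[−579/1480, −3/10] × {29/5}` (vertices: cov-la214-sdp-1 leg L3 + p610595) + the left-top chord -/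

/-- **The weights of the twin-overhang chord of «La214-E» (`[−579/1480, −3/10]`, the GENONLY twin vertex) at the (E6) short-overhang end `−153/400`**:
`407/450` on the twin vertex `−579/1480`, `43/450` on the corner `−3/10` (`33/400 ÷ 27/296` and its complement). [folklore] -/
theorem la214E_twinChord_weights_at_153o400 :
    (-3 / 10 - -(153 / 400) : ℝ) / (-3 / 10 - -(579 / 1480)) = 407 / 450 ∧
      (-(153 / 400) - -(579 / 1480) : ℝ) / (-3 / 10 - -(579 / 1480)) = 43 / 450 := by
  constructor <;> norm_num

/-- **`TransportFanCeiling` from the INS-B TWIN BUNDLE + the LEFT-TOP `U`-chord.** The corner-objective (`−X₀(−3/10)`) chord on the SHORT twin segment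
`[−579/1480, −3/10] × {29/5}` — vertex constants `vT` at `−579/1480` (the captain's INS-B vertex, cov-la214-sdp-1 leg L3 «cov1-stiffF0om3o10-GU29o5n1tpm579o1480») and
`vO₂` at `−3/10` (p610595) — read only on `[−153/400, −3/10]`, plus the left-top chord in `U` on `{−3/10} × [8, 74/5]` (`vL₁` at `(8; −3/10)` = C3, `vL₂` at
`(74/5; −3/10)` = C2). Conditions: `−vO₂, −vL₁, −vL₂ ≤ 0.4364687` and `−(407/450·vT + 43/450·vO₂) ≤ 0.4364687` (the twin chord read at `−153/400`; the twin vertex is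
almost fully load-bearing, weight `407/450 ≈ 0.904`). No far vertex `−357/740`, no inner family. [cite: KomaTasaki1994, §1] [cite: ScalapinoWhiteZhang1993, §II] -/
theorem transportFanCeiling_of_twinOverhangChord579o1480_and_leftEdgeTop8Chord (vT vO₂ vL₁ vL₂ : ℝ)
    (hcTm : -(407 / 450 * vT + 43 / 450 * vO₂) ≤ ((4364687 / 10000000 : ℚ) : ℝ)) (hcO₂ : -vO₂ ≤ ((4364687 / 10000000 : ℚ) : ℝ))
    (hcL₁ : -vL₁ ≤ ((4364687 / 10000000 : ℚ) : ℝ)) (hcL₂ : -vL₂ ≤ ((4364687 / 10000000 : ℚ) : ℝ))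
    (hTwin : ∀ s ∈ Set.Icc (-(579 / 1480) : ℝ) (-3 / 10),
      ∀ (ω : InfVolFermionState 2) (Ls : ℕ → ℕ) (ψ : ∀ L, Fock (Orb (FermionTorus 2 L))),
      Filter.Tendsto Ls Filter.atTop Filter.atTop →
      (∀ j, IsGroundStateInSector (hubbardTorusTT' (Ls j) 1 s (29 / 5)) (rectN 1 (Ls j)) 0 (ψ (Ls j))) →
      (∀ j, star (ψ (Ls j)) ⬝ᵥ ψ (Ls j) = 1) → ω.IsTorusLimitOf ψ Ls →
      (-3 / 10 - s) / (-3 / 10 - -(579 / 1480)) * vT + (s - -(579 / 1480)) / (-3 / 10 - -(579 / 1480)) * vO₂ ≤ ((Finset.univ : Finset (DihedralGroup 4)).card : ℝ)⁻¹ * ∑ g ∈ (Finset.univ : Finset (DihedralGroup 4)),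
        (ω.expect (d4ShiftSet g 0 (Literature.Probability.LatticeModels.box 2 7))
          (fermionEmbed (PolySite.d4Emb g 0 (Literature.Probability.LatticeModels.box 2 7)) (-oddMomentObsTT (-3 / 10) (29 / 5) 0))).re)
    (hLeftTop : ∀ U' ∈ Set.Icc (8 : ℝ) (74 / 5),
      ∀ (ω : InfVolFermionState 2) (Ls : ℕ → ℕ) (ψ : ∀ L, Fock (Orb (FermionTorus 2 L))),
      Filter.Tendsto Ls Filter.atTop Filter.atTop →
      (∀ j, IsGroundStateInSector (hubbardTorusTT' (Ls j) 1 (-3 / 10) U') (rectN 1 (Ls j)) 0 (ψ (Ls j))) →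
      (∀ j, star (ψ (Ls j)) ⬝ᵥ ψ (Ls j) = 1) → ω.IsTorusLimitOf ψ Ls →
      (74 / 5 - U') / (74 / 5 - 8) * vL₁ + (U' - 8) / (74 / 5 - 8) * vL₂ ≤ ((Finset.univ : Finset (DihedralGroup 4)).card : ℝ)⁻¹ * ∑ g ∈ (Finset.univ : Finset (DihedralGroup 4)),
        (ω.expect (d4ShiftSet g 0 (Literature.Probability.LatticeModels.box 2 7))
          (fermionEmbed (PolySite.d4Emb g 0 (Literature.Probability.LatticeModels.box 2 7)) (-oddMomentObsTT (-3 / 10) U' 0))).re) :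
    TransportFanCeiling := by
  refine transportFanCeiling_of_shortOverhang153o400_and_leftEdgeTop8
    (fun s => (-3 / 10 - s) / (-3 / 10 - -(579 / 1480)) * vT + (s - -(579 / 1480)) / (-3 / 10 - -(579 / 1480)) * vO₂)
    (fun U' => (74 / 5 - U') / (74 / 5 - 8) * vL₁ + (U' - 8) / (74 / 5 - 8) * vL₂)
    (fun s hs => hTwin s ⟨le_trans (by norm_num) hs.1, hs.2⟩) (fun s hs => ?_) hLeftTop (fun U' hU' => ?_)
  · have hmin := chord_min_le_on_rightSubsegment (a := -(579 / 1480)) (b := -3 / 10) (m := -(153 / 400)) (v₁ := vT) (v₂ := vO₂)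
      (by norm_num) hs.1 hs.2
    obtain ⟨e1, e2⟩ := la214E_twinChord_weights_at_153o400
    rw [e1, e2] at hmin
    have hneg : -min (407 / 450 * vT + 43 / 450 * vO₂) vO₂ ≤ ((4364687 / 10000000 : ℚ) : ℝ) := by
      rcases le_total (407 / 450 * vT + 43 / 450 * vO₂) vO₂ with hv | hv
      · rw [min_eq_left hv]; exact hcTm
      · rw [min_eq_right hv]; exact hcO₂
    linarith
  · exact neg_chord_le_of_ends (by norm_num) hU' hcL₁ hcL₂

end Summit.Ventures.CertifiedManyBodySolver.Theorems

end
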